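import Literature.NumberTheory.Rogawski1990.ArchTransfFamilyJumpAllOrders   -- PART 3e (LH7-p02 (g2)): `(P_n)` `transfFam_hasOneSidedJump_allOrders`; brings PART 3a–3d, PART 2 (ED. 1), ★ (π), ★ (SB-TRANSF)
import HarnessLib

/-!
# (I₃) for the candidate transfer family — PART 3f (HEAD): the zero branches at all orders and
# `archBzJump_transfFam_of_hc : ArchHCSpaceG (slotSign L α) jc′ F → AgreesOnAdmissibleCoveredSlots L α jc′ jcH → ArchBzJump jcH (transfFam L α μ F)`
# (Shelstad 1979 Thm. 4.7 (IIIb); Bouaziz 1994 §3.2 (I₃), Rem. 2 p. 594; Rogawski 1990 §4.3 (4.3.1))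

Topic `NumberTheory/Rogawski1990`; namespace `Literature.NumberTheory.Rogawski1990`.  THEOREMS ONLY (no `def`, no instance, no notation, no axiom, no named fact, no `sorry`).
Cell `pub/hodgecm-mathlib`, line LH3 (closer stub `stub_N9`, crux H413 = `stmt-HodgeConjecture-24833`), organ **O-L2 (I₃-TRANSF) — THE HEAD** (LH3-plan (g3) DEALER BOARD g3 #1 (iv),
RULING #2; author LH7-p02 (g2); (π) ★ F0P3a-p02 (g19), (SB-TRANSF) ★ LH3-p04 (g3), generic calculus ★ F0P3a-p09 (g5)).  HONEST LABEL: HC_CM is proved only modulo the 7 printed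
citations (2 remaining: hLiu418 = `stmt-HodgeConjecture-24832`, h413 = `stmt-HodgeConjecture-24833`) until rung 0 closes; count-neutral.

THE MATHEMATICS.  ★ (π) `archBzJump_of_forall_gSemireg` (continuity of the one-sided jets along the wall + density) reduces Bouaziz's (I₃) for `transfFam` to the pointwise jump
identities at the `G`-semiregular wall points; ★ (SB-TRANSF) supplies its smoothness hypothesis.  At an ADMISSIBLE COVERED wall the identity is PART 3e's `(P_n)` with
`jcH S w₀ = 2·jc′ S w₀ 0 2` (★ `AgreesOnAdmissibleCoveredSlots`).  At the other walls both sides vanish at every order (§1): if `S` is inadmissible, `transfFam S = 0` and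
`transfFam (insert w₀ S) = 0` (★ `transfFam_eq_zero_of_not_admissible`); if `w₀` is UNCOVERED (a definite place of the house frame), `insert w₀ S` is inadmissible and every partner
point of `p` is tame, so the twisted jets of `transfFam S` along the normal are CONTINUOUS through the wall (PART 3d's expansion + PART 3a's continuity of the partner jets).
§2 assembles **`archBzJump_transfFam_of_hc`** — organ O-L2's jump clause, the last analytic input of the LH3 direct road's `stub_N9transf`.

## References
* [Shelstad1979] D. Shelstad, *Characters and inner forms of a quasi-split group over ℝ*, Compositio Math. 39 (1979), §4: Prop. 4.5 p. 26, Thm. 4.7 (IIIb) p. 31.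
* [Bouaziz1994IntegralesOrbitales] A. Bouaziz, *Intégrales orbitales sur les groupes de Lie réductifs*, Ann. Sci. ÉNS 27 (1994), §3.2 (I₃) p. 580, §6.2 p. 591, Rem. 2 p. 594.
* [Rogawski1990] J. D. Rogawski, *Automorphic Representations of Unitary Groups in Three Variables* (1990), §4.3 (4.3.1) p. 43, §14.2 p. 232.
-/

set_option autoImplicit false

noncomputable section

open NumberField NumberField.InfinitePlace Complex Set Filter Topology Equiv Finset
open scoped Classical Real ContDiff
open Literature.NumberTheory.Automorphic Literature.NumberTheory.Automorphic.UnitaryGroup Literature.NumberTheory.Automorphic.ArchCartan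
open Literature.NumberTheory.Automorphic.Shelstad1979.StableOrbitalIntegrals
open Literature.NumberTheory.GaloisRepresentations
open Literature.Analysis.Calculus

namespace Literature.NumberTheory.Rogawski1990

/-! ## §1 The zero branches at all orders -/

section Zero

variable (L : Type) [Field L] [NumberField L] [IsCMField L] (α : Fin 3 → L) (μ : HeckeCharacter L)

/-- The twisted iterated derivative of the zero family vanishes. [cite: Bouaziz1994IntegralesOrbitales, §6.2 p. 591] -/
theorem bzTwistedDeriv_zero_family {W : Type*} [Fintype W] [DecidableEq W] (S : Finset W) (n : ℕ) (dirs : Fin n → (W → Fin 3 → ℝ)) (c : W → Fin 3 → ℝ) :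
    bzTwistedDeriv S n dirs (fun _ => (0 : ℂ)) c = 0 := by
  unfold bzTwistedDeriv
  simp only [mul_zero, iteratedFDeriv_fun_zero, Pi.zero_apply, zero_apply]

/-- **Inadmissible chart, all orders**: `transfFam S = 0` and `transfFam (insert w₀ S) = 0`, so the clause holds with any constant. [cite: Rogawski1990, §4.3 (4.3.1) p. 43]
[cite: Bouaziz1994IntegralesOrbitales, Rem. 2 p. 594] -/
theorem transfFam_hasOneSidedJump_allOrders_of_not_admissible {S : Finset {w : InfinitePlace L // IsComplex w}} (hS : ¬ ∀ w, w ∈ S → w ∈ splitChartPlaces L α)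
    (w₀ : {w : InfinitePlace L // IsComplex w}) (F : Finset {w : InfinitePlace L // IsComplex w} → ({w : InfinitePlace L // IsComplex w} → Fin 3 → ℝ) → ℂ) (s : {w : InfinitePlace L // IsComplex w} → Fin 3 → ℝ) (cst : ℂ) (n : ℕ) (m : Fin n → {w : InfinitePlace L // IsComplex w} × Fin 3) :
    HasOneSidedJump (fun t : ℝ => bzTwistedDeriv S n (fun j => bzAdaptedVec w₀ (m j)) (transfFam L α μ F S) (s + t • nrm w₀))
      (cst * bzCayScalar w₀ m * bzTwistedDeriv (insert w₀ S) n (fun j => (bzCayVec (m j) : {w : InfinitePlace L // IsComplex w} → Fin 3 → ℝ)) (transfFam L α μ F (insert w₀ S)) (cayPt w₀ s)) := by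
  have hS'' : ¬ ∀ w, w ∈ insert w₀ S → w ∈ splitChartPlaces L α := fun h => hS fun w hw => h w (Finset.mem_insert_of_mem hw)
  rw [transfFam_eq_zero_of_not_admissible L α μ F hS, transfFam_eq_zero_of_not_admissible L α μ F hS'']
  simp only [bzTwistedDeriv_zero_family, mul_zero]
  exact hasOneSidedJump_zero_of_tendsto tendsto_const_nhds

/-- **Uncovered wall, all orders** (admissible `S`, compact `w₀ ∉ S` at a DEFINITE place of the house frame): every partner point of the `G`-semiregular wall point `p` is tame, so the
twisted jets of `transfFam S` along the normal are CONTINUOUS through the wall (jump `0`), and `insert w₀ S` is inadmissible (Cayley side `0`). [cite: Rogawski1990, §14.2 p. 232]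
[cite: Shelstad1979, §4 p. 23] [cite: Bouaziz1994IntegralesOrbitales, §3.2 (I₁) p. 579] -/
theorem transfFam_hasOneSidedJump_allOrders_of_not_mem_splitChartPlaces (hα : ∀ i, α i ≠ 0)
    (hreal : ∀ (w : {w : InfinitePlace L // IsComplex w}) (i : Fin 3), (w.1.embedding (α i)).im = 0)
    (hμω : ∀ x : ideleGroup ↥(maximalRealSubfield L), μ (AdeleRing.ideleBaseChange (↥(maximalRealSubfield L)) L x) = quadraticHeckeCharCM L x)
    {S : Finset {w : InfinitePlace L // IsComplex w}} (hS : ∀ w ∈ S, w ∈ splitChartPlaces L α)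
    {w₀ : {w : InfinitePlace L // IsComplex w}} (hw₀ : w₀ ∉ S) (hcov : w₀ ∉ splitChartPlaces L α)
    {jc' : Finset {w : InfinitePlace L // IsComplex w} → {w : InfinitePlace L // IsComplex w} → Fin 3 → Fin 3 → ℂ}
    {F : Finset {w : InfinitePlace L // IsComplex w} → ({w : InfinitePlace L // IsComplex w} → Fin 3 → ℝ) → ℂ} (hF : ArchHCSpaceG (slotSign L α) jc' F)
    {p : {w : InfinitePlace L // IsComplex w} → Fin 3 → ℝ} (hs02 : p w₀ 0 = p w₀ 2) (hs1 : Circle.exp (p w₀ 1) ≠ Circle.exp (p w₀ 0))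
    (hreg : ∀ v, v ∉ S → v ≠ w₀ → Function.Injective fun i : Fin 3 => Circle.exp (p v i)) (hx : ∀ v ∈ S, p v 0 ≠ 0)
    (cst : ℂ) (n : ℕ) (m : Fin n → {w : InfinitePlace L // IsComplex w} × Fin 3) :
    HasOneSidedJump (fun t : ℝ => bzTwistedDeriv S n (fun j => bzAdaptedVec w₀ (m j)) (transfFam L α μ F S) (p + t • nrm w₀))
      (cst * bzCayScalar w₀ m * bzTwistedDeriv (insert w₀ S) n (fun j => (bzCayVec (m j) : {w : InfinitePlace L // IsComplex w} → Fin 3 → ℝ)) (transfFam L α μ F (insert w₀ S)) (cayPt w₀ p)) := by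
  obtain ⟨k, hk⟩ := exists_archTau_mul_archWeylRatio_endoTorus_eq L μ hμω
  -- the Cayley side vanishes
  have hS'' : ¬ ∀ w, w ∈ insert w₀ S → w ∈ splitChartPlaces L α := fun h => hcov (h w₀ (Finset.mem_insert_self w₀ S))
  rw [transfFam_eq_zero_of_not_admissible L α μ F hS'', bzTwistedDeriv_zero_family, mul_zero]
  -- `w₀` is definite, every partner point of `p` is tame
  have hdef : ¬ IsIndefiniteAt (slotSign L α) w₀ := by
    intro hind
    refine hcov (mem_splitChartPlaces_of_frame hα (hreal w₀) ?_)
    rintro ⟨h01, h12⟩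
    have hall : ∀ i, formSign L α w₀ i = formSign L α w₀ 0 := by
      intro i; fin_cases i
      · rfl
      · exact h01.symm
      · exact h12.symm.trans h01.symm
    exact hind ⟨(hall _).trans (hall _).symm, (hall _).trans (hall _).symm⟩
  have htame : ∀ ρ ∈ partnerPerms S, slotPerm ρ p ∈ InRegG (slotSign L α) S := by
    refine forall_slotPerm_mem_inRegG_of_injective (slotSign L α) S fun w hw hind => ?_
    have hne : w ≠ w₀ := by rintro rfl; exact hdef hind
    exact hreg w hw hne
  have hI1 : ContDiffOn ℝ ∞ (F S) (InRegG (slotSign L α) S) := (hF.2.2.1 S).1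
  obtain ⟨hev, -⟩ := eventually_nhdsNE_mem_regG_add_smul_nrm hw₀ hs02 hs1 hreg hx
  -- Step A: the eventual expansion along the normal (as in PART 3e)
  have hA : ∀ᶠ t in 𝓝[≠] (0 : ℝ), bzTwistedDeriv S n (fun j => bzAdaptedVec w₀ (m j)) (transfFam L α μ F S) (p + t • nrm w₀) =
      (archERho S (p + t • nrm w₀))⁻¹ * ∑ s : Finset (Fin n),
        iteratedFDeriv ℝ s.card (fun c : {w : InfinitePlace L // IsComplex w} → Fin 3 → ℝ => partnerWeight L α S * (archERho S c * (∏ w : {w : InfinitePlace L // IsComplex w}, (if w ∈ S then Complex.exp (((2 * k w + 1 : ℤ) : ℂ) * ((c w 2 : ℂ) * I))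
            else (((Circle.exp (c w 0) : ℂ) * Circle.exp (c w 2)) ^ (k w)) * (Circle.exp (c w 2) : ℂ))))) (p + t • nrm w₀) (fun i => bzAdaptedVec w₀ (m (s.orderEmbOfFin rfl i))) *
        ∑ ρ ∈ partnerPerms S, (((∏ w : {w : InfinitePlace L // IsComplex w},
            ((SignType.sign ((w.1.embedding (α (lineOf (formSign L α w) ((ρ w).symm 1)))).re) : ℤ) * archMajoritySign L (Matrix.diagonal α) w) : ℤ) : ℂ) *
          ∏ w : {w : InfinitePlace L // IsComplex w}, (Equiv.Perm.sign (ρ w) : ℂ)) *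
          iteratedFDeriv ℝ sᶜ.card (fun c => archERhoG S (slotPerm ρ c) * F S (slotPerm ρ c)) (p + t • nrm w₀) (fun i => bzAdaptedVec w₀ (m (sᶜ.orderEmbOfFin rfl i))) := by
    filter_upwards [hev] with t ht
    have htame_t : ∀ ρ ∈ partnerPerms S, slotPerm ρ (p + t • nrm w₀) ∈ InRegG (slotSign L α) S := forall_slotPerm_mem_inRegG_of_mem_regG (slotSign L α) S ht
    have hloc := archERho_mul_transfFam_eventuallyEq_of_tame L α μ hS F hI1 k (hk S) (regS_subset_inRegS S (regG_subset_regS S ht)) htame_t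
    have hexp := iteratedFDeriv_apply_eq_sum_of_eventuallyEq_resolved L α hI1 k (partnerWeight L α S) htame_t hloc n (fun j => bzAdaptedVec w₀ (m j))
    simp only [Function.comp_def] at hexp
    unfold bzTwistedDeriv
    rw [hexp]
    congr 1
    simp only [Finset.mul_sum]
    rw [Finset.sum_comm]
    refine Finset.sum_congr rfl fun s _ => Finset.sum_congr rfl fun ρ _ => ?_
    ring
  -- Step B: every factor is continuous through `t = 0`
  have hcurve : Tendsto (fun t : ℝ => p + t • nrm w₀) (𝓝 (0 : ℝ)) (𝓝 p) := by
    have hc : Continuous fun t : ℝ => p + t • nrm w₀ := continuous_const.add (continuous_id.smul continuous_const)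
    have h := hc.tendsto 0
    simp only [zero_smul, add_zero] at h
    exact h
  have hcontρ : Continuous (archERho S : ({w : InfinitePlace L // IsComplex w} → Fin 3 → ℝ) → ℂ) := by
    unfold archERho
    refine continuous_finsetProd _ fun w _ => ?_
    by_cases hw : w ∈ S
    · simp only [if_pos hw]
      exact continuous_const
    · simp only [if_neg hw]
      have h0 : Continuous fun c : {w : InfinitePlace L // IsComplex w} → Fin 3 → ℝ => c w 0 := (continuous_apply 0).comp (continuous_apply w)
      have h2 : Continuous fun c : {w : InfinitePlace L // IsComplex w} → Fin 3 → ℝ => c w 2 := (continuous_apply 2).comp (continuous_apply w)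
      exact continuous_subtype_val.comp (Circle.exp.continuous.comp ((h0.sub h2).div_const 2))
  have hEρ : Tendsto (fun t : ℝ => (archERho S (p + t • nrm w₀))⁻¹) (𝓝 (0 : ℝ)) (𝓝 (archERho S p)⁻¹) :=
    ((hcontρ.tendsto p).comp hcurve).inv₀ (archERho_ne_zero S p)
  have hW : ContDiff ℝ ∞ (fun c : {w : InfinitePlace L // IsComplex w} → Fin 3 → ℝ => partnerWeight L α S * (archERho S c * (∏ w : {w : InfinitePlace L // IsComplex w}, (if w ∈ S then Complex.exp (((2 * k w + 1 : ℤ) : ℂ) * ((c w 2 : ℂ) * I))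
            else (((Circle.exp (c w 0) : ℂ) * Circle.exp (c w 2)) ^ (k w)) * (Circle.exp (c w 2) : ℂ))))) := contDiff_const_mul_archERho_mul_unit S k _
  have hAt : ∀ s : Finset (Fin n), Tendsto (fun t : ℝ =>
      iteratedFDeriv ℝ s.card (fun c : {w : InfinitePlace L // IsComplex w} → Fin 3 → ℝ => partnerWeight L α S * (archERho S c * (∏ w : {w : InfinitePlace L // IsComplex w}, (if w ∈ S then Complex.exp (((2 * k w + 1 : ℤ) : ℂ) * ((c w 2 : ℂ) * I))
            else (((Circle.exp (c w 0) : ℂ) * Circle.exp (c w 2)) ^ (k w)) * (Circle.exp (c w 2) : ℂ))))) (p + t • nrm w₀) (fun i => bzAdaptedVec w₀ (m (s.orderEmbOfFin rfl i)))) (𝓝 (0 : ℝ))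
      (𝓝 (iteratedFDeriv ℝ s.card (fun c : {w : InfinitePlace L // IsComplex w} → Fin 3 → ℝ => partnerWeight L α S * (archERho S c * (∏ w : {w : InfinitePlace L // IsComplex w}, (if w ∈ S then Complex.exp (((2 * k w + 1 : ℤ) : ℂ) * ((c w 2 : ℂ) * I))
            else (((Circle.exp (c w 0) : ℂ) * Circle.exp (c w 2)) ^ (k w)) * (Circle.exp (c w 2) : ℂ))))) p (fun i => bzAdaptedVec w₀ (m (s.orderEmbOfFin rfl i))))) := fun s =>
    ((continuous_eval_const _).tendsto _).comp (((hW.continuous_iteratedFDeriv (m := s.card) (by exact_mod_cast le_top)).tendsto p).comp hcurve)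
  have hBt : ∀ s : Finset (Fin n), Tendsto (fun t : ℝ => ∑ ρ ∈ partnerPerms S, (((∏ w : {w : InfinitePlace L // IsComplex w},
            ((SignType.sign ((w.1.embedding (α (lineOf (formSign L α w) ((ρ w).symm 1)))).re) : ℤ) * archMajoritySign L (Matrix.diagonal α) w) : ℤ) : ℂ) *
          ∏ w : {w : InfinitePlace L // IsComplex w}, (Equiv.Perm.sign (ρ w) : ℂ)) *
      iteratedFDeriv ℝ sᶜ.card (fun c => archERhoG S (slotPerm ρ c) * F S (slotPerm ρ c)) (p + t • nrm w₀) (fun i => bzAdaptedVec w₀ (m (sᶜ.orderEmbOfFin rfl i)))) (𝓝 (0 : ℝ))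
      (𝓝 (∑ ρ ∈ partnerPerms S, (((∏ w : {w : InfinitePlace L // IsComplex w},
            ((SignType.sign ((w.1.embedding (α (lineOf (formSign L α w) ((ρ w).symm 1)))).re) : ℤ) * archMajoritySign L (Matrix.diagonal α) w) : ℤ) : ℂ) *
          ∏ w : {w : InfinitePlace L // IsComplex w}, (Equiv.Perm.sign (ρ w) : ℂ)) *
        iteratedFDeriv ℝ sᶜ.card (fun c => archERhoG S (slotPerm ρ c) * F S (slotPerm ρ c)) p (fun i => bzAdaptedVec w₀ (m (sᶜ.orderEmbOfFin rfl i))))) := fun s =>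
    tendsto_finsetSum _ fun ρ hρ => (tendsto_iteratedFDeriv_twisted_slotPerm L α hI1 ρ (htame ρ hρ) w₀ sᶜ.card _).const_mul _
  have hlim := hEρ.mul (tendsto_finsetSum (Finset.univ : Finset (Finset (Fin n))) fun s _ => (hAt s).mul (hBt s))
  refine hasOneSidedJump_congr_eventuallyEq (hasOneSidedJump_zero_of_tendsto hlim) ?_
  filter_upwards [hA] with t ht
  rw [ht]

end Zero

/-! ## §2 THE HEAD: organ O-L2's jump clause -/

section Head

variable (L : Type) [Field L] [NumberField L] [IsCMField L] (α : Fin 3 → L) (μ : HeckeCharacter L)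

/-- **(I₃) FOR THE CANDIDATE TRANSFER FAMILY — `ArchBzJump jcH (transfFam L α μ F)`.**  House frame `α_i ≠ 0` real at every place, `μ`-guard `hμω`; `F` in Harish-Chandra's space
`ArchHCSpaceG (slotSign L α) jc′` on the `G′`-side; the `H`-side constants `jcH` agree with `2·jc′ · 0 2` at the admissible covered walls (★ `AgreesOnAdmissibleCoveredSlots`).  Then the
candidate transfer `transfFam L α μ F` satisfies Bouaziz's (I₃) on `H_∞`: at every compact wall of every chart, every semiregular wall point, every order and word, its twisted
iterated derivative along the normal jumps by `jcH S w₀ · I^{#normal} ·` the Cayley reading — Shelstad's (IIIb) `2i·Φ^{T_s}`, Bouaziz's `d(s) = 2`.  Proof: ★ (π)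
`archBzJump_of_forall_gSemireg` over ★ (SB-TRANSF) `archBzSmoothBounded_transfFam_of_hc`, fed with `(P_n)` (PART 3e) at the admissible covered walls and with §1's zero branches
elsewhere. [cite: Shelstad1979, Thm. 4.7 (IIIb) p. 31; Prop. 4.5 p. 26] [cite: Bouaziz1994IntegralesOrbitales, §3.2 (I₃) p. 580; Rem. 2 p. 594] [cite: Rogawski1990, §4.3 (4.3.1) p. 43] -/
theorem archBzJump_transfFam_of_hc (hα : ∀ i, α i ≠ 0)
    (hreal : ∀ (w : {w : InfinitePlace L // IsComplex w}) (i : Fin 3), (w.1.embedding (α i)).im = 0)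
    (hμω : ∀ x : ideleGroup ↥(maximalRealSubfield L), μ (AdeleRing.ideleBaseChange (↥(maximalRealSubfield L)) L x) = quadraticHeckeCharCM L x)
    {jc' : Finset {w : InfinitePlace L // IsComplex w} → {w : InfinitePlace L // IsComplex w} → Fin 3 → Fin 3 → ℂ} {jcH : Finset {w : InfinitePlace L // IsComplex w} → {w : InfinitePlace L // IsComplex w} → ℂ}
    {F : Finset {w : InfinitePlace L // IsComplex w} → ({w : InfinitePlace L // IsComplex w} → Fin 3 → ℝ) → ℂ} (hF : ArchHCSpaceG (slotSign L α) jc' F)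
    (hagree : AgreesOnAdmissibleCoveredSlots L α jc' jcH) :
    ArchBzJump jcH (transfFam L α μ F) := by
  refine archBzJump_of_forall_gSemireg (archBzSmoothBounded_transfFam_of_hc L α μ hα hreal hμω hF) fun S w₀ hw₀ p hs02 hs1 hreg hx n m => ?_
  by_cases hS : ∀ w, w ∈ S → w ∈ splitChartPlaces L α
  · by_cases hcov : w₀ ∈ splitChartPlaces L α
    · obtain ⟨-, hind⟩ := slotSign_zero_ne_two_of_mem_splitChartPlaces L α hα hcov
      rw [hagree S w₀ hS ⟨hw₀, hind⟩]
      exact transfFam_hasOneSidedJump_allOrders L α μ hα hμω hS hw₀ hcov hF hs02 hs1 hreg hx n m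
    · exact transfFam_hasOneSidedJump_allOrders_of_not_mem_splitChartPlaces L α μ hα hreal hμω hS hw₀ hcov hF hs02 hs1 hreg hx (jcH S w₀) n m
  · exact transfFam_hasOneSidedJump_allOrders_of_not_admissible L α μ hS w₀ F p (jcH S w₀) n m

end Head

end Literature.NumberTheory.Rogawski1990

end
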